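import Mathlib
import Literature.Combinatorics.Enumerative.VanDerWaerdenPermanent
import Literature.Combinatorics.Enumerative.PermanentProductForm
import Literature.Combinatorics.StablePolynomials.ProductLinearForms
import Literature.Combinatorics.StablePolynomials.GurvitsCapacityBound
import HarnessLib

/-!
# The van der Waerden permanent bound (Egorychev–Falikman) — proof

Discharge of the named fact `Literature.Combinatorics.Enumerative.VanDerWaerdenPermanent`
(`VanDerWaerdenPermanent.lean`; Egorychev 1981, Theorem 1, p. 300: `min_{X ∈ Ω_n} per X = n!/nⁿ`;
Falikman 1981): for every real `m × m` matrix `A` with nonnegative entries whose rows and columns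
all sum to `1`, `m! ≤ m^m · per A`.

The proof vendored here is L. Gurvits' capacity proof [Gurvits2008, §2.1, Example "the celebrated
Falikman's result `min_{A ∈ Ω_n} per(A) = n!/nⁿ`" following the Corollary "generalized Van der
Waerden inequality"], not Egorychev's original argument via the Alexandrov–Fenchel inequality for
mixed discriminants: with `p_A := ∏_i ∑_j A i j · z_j ∈ ℝ[z_0, …, z_{m-1}]`,
* `p_A` is real stable, has nonnegative coefficients, total degree `≤ m`, and capacity one,
  `∏_j x_j ≤ p_A(x)` for `x > 0` (`Gurvits.prod_rowForms_doublyStochastic`,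
  `StablePolynomials/ProductLinearForms.lean`);
* its multilinear coefficient is the permanent, `[z_0 ⋯ z_{m-1}] p_A = per A`
  (`coeff_prod_rowForms_eq_permanent_fin`, `PermanentProductForm.lean`);
* Gurvits' theorem `c · m! ≤ m^m · [z_0 ⋯ z_{m-1}] p` for `0`-or-real-stable `p` with nonnegative
  coefficients, total degree `≤ m` and `c · ∏ xᵢ ≤ p(x)` on `ℝ^m₊₊`
  (`Gurvits.factorial_mul_le_pow_mul_coeff_one`, `StablePolynomials/GurvitsCapacityBound.lean`),
  applied with `c = 1`.

## References

* G. P. Egorychev, *The solution of van der Waerden's problem for permanents*, Adv. in Math. 42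
  (1981) 299–305, Theorem 1 (p. 300). [Egorychev1981]
* D. I. Falikman, *Proof of the van der Waerden conjecture regarding the permanent of a doubly
  stochastic matrix*, Math. Notes 29 (1981) 475–479. [Falikman1981]
* L. Gurvits, *Van der Waerden/Schrijver–Valiant like conjectures and stable (aka hyperbolic)
  homogeneous polynomials: one theorem for all*, Electron. J. Combin. 15 (2008) R66
  (arXiv:0711.3496), §2 (Corollary "generalized Van der Waerden inequality") and §2.1 (Example:
  Falikman's result for `Ω_n`). [Gurvits2008]
* M. Laurent, A. Schrijver, *On Leonid Gurvits's proof for permanents*, Amer. Math. Monthly 117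
  (2010) 903–911. [LaurentSchrijver2010]
-/

namespace Literature.Combinatorics.Enumerative

open MvPolynomial

/-- **The van der Waerden permanent bound (Egorychev–Falikman theorem), proved**: for every `m`
and every real `m × m` matrix `A` with nonnegative entries whose rows and columns all sum to `1`,
`m! ≤ m^m · per A`.  Gurvits' proof: apply the capacity inequality
`Gurvits.factorial_mul_le_pow_mul_coeff_one` (with `c = 1`) to the real stable row-form product
`p_A = ∏_i ∑_j A i j · z_j`, whose multilinear coefficient is `per A`.
[cite: Egorychev1981, Theorem 1 (p. 300)] [cite: Gurvits2008, §2.1 (Example: Falikman's result)] -/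
theorem VanDerWaerdenPermanent_holds : VanDerWaerdenPermanent := by
  intro m A hA hrow hcol
  obtain ⟨hst, hcoef, hdeg, hcap⟩ :=
    Literature.Combinatorics.StablePolynomials.Gurvits.prod_rowForms_doublyStochastic m A hA hrow hcol
  have key :=
    Literature.Combinatorics.StablePolynomials.Gurvits.factorial_mul_le_pow_mul_coeff_one m
      (∏ i : Fin m, ∑ j : Fin m, C (A i j) * X j : MvPolynomial (Fin m) ℝ) hcoef hdeg (Or.inr hst) 1
      (fun x hx => by rw [one_mul]; exact hcap x hx)
  rw [coeff_prod_rowForms_eq_permanent_fin, one_mul] at key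
  exact key

end Literature.Combinatorics.Enumerative
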